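import Literature.Probability.RandomPlanarGeometry.SLEExistenceAt
import Literature.Probability.RandomPlanarGeometry.SLETransienceZeroOne
import HarnessLib

/-!
# Transience of the SLE trace entails its existence; `tendsto_norm_sleTrace_atTop ↔ exists_isSLECurve`

Topic `Probability/RandomPlanarGeometry`; theorems only, nothing is redefined and no named fact is
introduced. Bookkeeping on the named fact
`Literature.Probability.RandomPlanarGeometry.tendsto_norm_sleTrace_atTop` (`SLE.lean`; S. Rohde,
O. Schramm, *Basic properties of SLE*, Ann. of Math. 161 (2005), Thm. 7.1 "For all `κ ≠ 8` the
SLE_κ trace `γ(t)` is transient a.s.", with the Update (p. 924 / arXiv p. 18) "Corollary 7.4 and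
Theorem 7.1 are true also for `κ = 8` … based on the extension [LSW] to `κ = 8` of Theorem 5.1").

* `hasSLETrace_of_ae_tendsto_norm_sleTrace_atTop` (**proved**, every `κ`): in this library's
  encoding the SLE_κ trace `sleTrace κ ω = Loewner.trace (√κ B(ω))` is the chosen generating curve
  when the Loewner chain of `√κ B(ω)` is generated by a curve and the *constant* junk path
  `W 0 = 0` otherwise (`Loewner.trace`), whose norm does not tend to `∞`; hence almost sure
  transience of `sleTrace κ` already forces the chain to be a.s. generated by a curve
  (`HasSLETrace κ`). Consequently the target fact entails, in this encoding, the two trace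
  existence theorems it is usually quoted *after*: Lawler–Schramm–Werner (2004), Thm. 4.7
  (`hasSLETrace_eight_of_tendsto_norm_sleTrace_atTop`) and Rohde–Schramm (2005), Thm. 5.1
  (`hasSLETrace_of_ne_eight_of_tendsto_norm_sleTrace_atTop`; `κ = 0` is the proved
  `hasSLETrace_zero`).
* `tendsto_norm_sleTrace_atTop_iff_exists_isSLECurve` (**proved**): the two named facts
  `tendsto_norm_sleTrace_atTop` and `exists_isSLECurve` of `SLE.lean` are **equivalent**
  (`→`: the previous item and `exists_isSLECurve_of_forall_hasSLETrace_transient` of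
  `SLEExistenceAt`, i.e. Riemann mapping, Carathéodory and measurability of the trace, all proved
  in the tree; `←`: `tendsto_norm_sleTrace_atTop_of_exists_isSLECurve` of `SLEExistenceConverse`).
  So `exists_isSLECurve_iff` loses two of its three conjuncts
  (`exists_isSLECurve_iff_tendsto_norm_sleTrace_atTop'`).
* `tendsto_norm_sleTrace_atTop_iff_forall_measure_ne_zero` (**proved**): the exact remaining
  content of the fact, for each `κ > 0` separately — SLE_κ is a.s. generated by a curve **and**
  `0 ∉ cl γ[1, ∞)` with merely *positive* probability (the zero-one law and the scaling step of
  the printed proof of Thm. 7.1, `tendsto_norm_sleTrace_atTop_iff_measure_ne_zero` of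
  `SLETransienceZeroOne`, supply the rest).

## References

* S. Rohde, O. Schramm, *Basic properties of SLE*, Ann. of Math. 161 (2005) 883–924, Thm. 5.1,
  Thm. 7.1 and its proof (p. 911), Update (p. 924).
* G. F. Lawler, O. Schramm, W. Werner, *Conformal invariance of planar loop-erased random walks
  and uniform spanning trees*, Ann. Probab. 32 (2004) 939–995, Thm. 4.7.
-/

noncomputable section

open Set Filter Topology MeasureTheory
open scoped NNReal

namespace Literature.Probability.RandomPlanarGeometry

variable {κ : ℝ≥0}

/-! ### Almost sure transience forces the chain to be generated by a curve -/

/-- **A.s. transience of `sleTrace κ` entails `HasSLETrace κ`.** If the Loewner chain of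
`√κ B(ω)` is not generated by a curve, `sleTrace κ ω` is the constant junk path `0`
(`Loewner.trace`, `sleDriving_zero`), and a constant path is not transient
(`Filter.not_tendsto_const_atTop`); so on the full-measure set where `|γ(t)| → ∞` a generating
curve exists. In Rohde–Schramm (2005) the trace of Thm. 7.1 is the path provided by Thm. 5.1
(and by [LSW] at `κ = 8`); this lemma records that the library's encoding of Thm. 7.1 carries that
existence statement with it. [cite: RohdeSchramm2005, Thm 7.1 and Thm 5.1] -/
theorem hasSLETrace_of_ae_tendsto_norm_sleTrace_atTop
    (h : ∀ᵐ ω ∂Process.preWienerMeasure, Tendsto (fun t ↦ ‖sleTrace κ ω t‖) atTop atTop) :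
    HasSLETrace κ := by
  filter_upwards [h] with ω hω
  by_contra hne
  have hconst : sleTrace κ ω = fun _ ↦ ((sleDriving κ ω 0 : ℝ) : ℂ) := by
    unfold sleTrace Loewner.trace
    rw [dif_neg hne]
  rw [hconst] at hω
  exact not_tendsto_const_atTop _ atTop hω

/-- The named fact `tendsto_norm_sleTrace_atTop` entails `HasSLETrace κ` for every `κ > 0`
(Rohde–Schramm (2005), Thm. 5.1 for `κ ≠ 8`, Lawler–Schramm–Werner (2004), Thm. 4.7 for `κ = 8`,
as encoded). [cite: RohdeSchramm2005, Thm 7.1 and Thm 5.1] -/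
theorem hasSLETrace_of_tendsto_norm_sleTrace_atTop (h : tendsto_norm_sleTrace_atTop)
    (hκ : 0 < κ) : HasSLETrace κ :=
  hasSLETrace_of_ae_tendsto_norm_sleTrace_atTop (h hκ)

/-- **The transience fact entails the SLE₈ trace theorem** `hasSLETrace_eight`
(Lawler–Schramm–Werner (2004), Thm. 4.7) in this encoding. [cite: LawlerSchrammWerner2004, Thm 4.7] -/
theorem hasSLETrace_eight_of_tendsto_norm_sleTrace_atTop (h : tendsto_norm_sleTrace_atTop) :
    hasSLETrace_eight :=
  hasSLETrace_of_tendsto_norm_sleTrace_atTop h (by norm_num)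

/-- **The transience fact entails Rohde–Schramm's Thm. 5.1** `hasSLETrace_of_ne_eight` in this
encoding (`κ > 0` from the fact, `κ = 0` being the proved `hasSLETrace_zero`: the chain of the
zero driving function is generated by `t ↦ 2i√t`). [cite: RohdeSchramm2005, Thm 5.1] -/
theorem hasSLETrace_of_ne_eight_of_tendsto_norm_sleTrace_atTop (h : tendsto_norm_sleTrace_atTop) :
    hasSLETrace_of_ne_eight := by
  intro κ _
  rcases eq_or_ne κ 0 with rfl | hκ
  · exact hasSLETrace_zero
  · exact hasSLETrace_of_tendsto_norm_sleTrace_atTop h (pos_iff_ne_zero.2 hκ)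

/-! ### `tendsto_norm_sleTrace_atTop ↔ exists_isSLECurve` -/

/-- **The transience fact entails the existence of chordal SLE_κ curves in every Dobrushin
domain** (`exists_isSLECurve`): for each `κ > 0` it provides both inputs of the per-`κ`
construction `exists_isSLECurve_at` — generation by a curve
(`hasSLETrace_of_tendsto_norm_sleTrace_atTop`) and a.s. transience — the conformal transport
(Riemann mapping, Carathéodory, measurability of the trace) being proved in `SLEExistenceAt`.
[cite: RohdeSchramm2005, Thm 5.1 and Thm 7.1] -/
theorem exists_isSLECurve_of_tendsto_norm_sleTrace_atTop (h : tendsto_norm_sleTrace_atTop) :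
    exists_isSLECurve :=
  exists_isSLECurve_of_forall_hasSLETrace_transient fun _ hκ ↦
    ⟨hasSLETrace_of_tendsto_norm_sleTrace_atTop h hκ, h hκ⟩

/-- **The named facts `tendsto_norm_sleTrace_atTop` and `exists_isSLECurve` are equivalent.**
`→` is `exists_isSLECurve_of_tendsto_norm_sleTrace_atTop`; `←` is
`tendsto_norm_sleTrace_atTop_of_exists_isSLECurve` (`SLEExistenceConverse`: an SLE_κ random curve
has a compactified image ending at `b`, so the trace is transient). Discharging either fact
discharges the other. [cite: RohdeSchramm2005, Thm 5.1 and Thm 7.1] -/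
theorem tendsto_norm_sleTrace_atTop_iff_exists_isSLECurve :
    tendsto_norm_sleTrace_atTop ↔ exists_isSLECurve :=
  ⟨exists_isSLECurve_of_tendsto_norm_sleTrace_atTop, tendsto_norm_sleTrace_atTop_of_exists_isSLECurve⟩

/-- `exists_isSLECurve_iff` with its redundant conjuncts removed: of the three trace theorems
(`hasSLETrace_eight`, `hasSLETrace_of_ne_eight`, `tendsto_norm_sleTrace_atTop`) the third entails
the first two in this encoding. [cite: RohdeSchramm2005, Thm 5.1 and Thm 7.1] -/
theorem exists_isSLECurve_iff_tendsto_norm_sleTrace_atTop' :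
    (hasSLETrace_eight ∧ hasSLETrace_of_ne_eight ∧ tendsto_norm_sleTrace_atTop) ↔
      tendsto_norm_sleTrace_atTop :=
  ⟨fun h ↦ h.2.2, fun h ↦ ⟨hasSLETrace_eight_of_tendsto_norm_sleTrace_atTop h,
    hasSLETrace_of_ne_eight_of_tendsto_norm_sleTrace_atTop h, h⟩⟩

/-! ### The exact remaining content, one `κ` at a time -/

/-- **`tendsto_norm_sleTrace_atTop`, characterised.** The fact holds iff for every `κ > 0`:
SLE_κ is a.s. generated by a curve, and `0 ∉ cl γ[1, ∞)` with *positive* probability. `→`: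
`hasSLETrace_of_tendsto_norm_sleTrace_atTop` and `measure_ne_zero_of_tendsto_norm_sleTrace_atTop`
(a.s. transience gives the event probability one); `←`:
`tendsto_norm_sleTrace_atTop_of_forall_measure_ne_zero` (scaling step of the printed proof of
Thm. 7.1, p. 911, and Kolmogorov's zero-one law, `SLETransienceZeroOne`). This isolates what is
left to prove for each `κ`: Thm. 5.1 / [LSW] Thm. 4.7 at `κ`, and a positive-probability version of
Lemma 7.2 (`κ ≤ 4`, via the simple-path step) or Lemma 7.3 (`κ > 4`).
[cite: RohdeSchramm2005, Thm 7.1 and its proof (p. 911)] -/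
theorem tendsto_norm_sleTrace_atTop_iff_forall_measure_ne_zero :
    tendsto_norm_sleTrace_atTop ↔
      ∀ κ : ℝ≥0, 0 < κ → HasSLETrace κ ∧
        Process.preWienerMeasure {ω | (0 : ℂ) ∉ closure (sleTrace κ ω '' Ici 1)} ≠ 0 := by
  refine ⟨fun h κ hκ ↦ ?_, fun h ↦
    tendsto_norm_sleTrace_atTop_of_forall_measure_ne_zero (fun κ hκ ↦ (h κ hκ).1)
      fun κ hκ ↦ (h κ hκ).2⟩
  have hT : HasSLETrace κ := hasSLETrace_of_tendsto_norm_sleTrace_atTop h hκ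
  exact ⟨hT, measure_ne_zero_of_tendsto_norm_sleTrace_atTop hT (h hκ)⟩

/-- Per-`κ` form of the same characterisation: a.s. transience of `sleTrace κ` is equivalent to
"generated by a curve a.s., and `0 ∉ cl γ[1, ∞)` with positive probability" — the hypothesis
`HasSLETrace κ` of `tendsto_norm_sleTrace_atTop_iff_measure_ne_zero` moved to the right-hand
side, where it is forced. [cite: RohdeSchramm2005, Thm 7.1 and its proof (p. 911)] -/
theorem ae_tendsto_norm_sleTrace_atTop_iff :
    (∀ᵐ ω ∂Process.preWienerMeasure, Tendsto (fun t ↦ ‖sleTrace κ ω t‖) atTop atTop) ↔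
      HasSLETrace κ ∧
        Process.preWienerMeasure {ω | (0 : ℂ) ∉ closure (sleTrace κ ω '' Ici 1)} ≠ 0 := by
  refine ⟨fun h ↦ ?_, fun h ↦ tendsto_norm_sleTrace_atTop_of_measure_ne_zero h.1 h.2⟩
  have hT : HasSLETrace κ := hasSLETrace_of_ae_tendsto_norm_sleTrace_atTop h
  exact ⟨hT, measure_ne_zero_of_tendsto_norm_sleTrace_atTop hT h⟩

end Literature.Probability.RandomPlanarGeometry

end
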